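import Literature.Topology.FourManifolds.StraightLineIsotopyExtension
import Mathlib.Analysis.InnerProductSpace.Calculus
import Mathlib.Analysis.InnerProductSpace.PiL2
import Mathlib.Analysis.Normed.Module.Connected
import Mathlib.Analysis.SpecialFunctions.Trigonometric.Deriv
import Mathlib.Geometry.Euclidean.Inversion.Basic
import HarnessLib

/-!
# Germs of plane diffeomorphisms fixing the unit circle pointwise: the straight-line hypothesis

Topic `Literature/Topology/FourManifolds` (support file for the Torelli half of Griffiths'
handlebody theorem, `stmt-SmoothPoincare4-15190`; planar analysis for the straightening of a
boundary diffeomorphism near the trace circles).  Everything here is **proved**; the one new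
definition is the unit tangent field (quarter-turn); the inversion is Mathlib's.

Hirsch, *Differential Topology* (1976), Ch. 8 §1, Thm. 1.3 and Ch. 4 §5 (uniqueness of tubular
neighbourhoods): an embedding which is the identity on a compact submanifold `Z` is isotoped to
a standard form near `Z` through the straight-line isotopy `h_t = id + t (P - id)`, provided the
derivatives `id + t (DP - id)` stay injective along `Z` (the tree's
`exists_ambientIsotopy_of_straightLine_of_subset`, `StraightLineAmbientIsotopySupport.lean`).
For `Z` the unit circle of the plane and `P` a local diffeomorphism with `P = id` on `Z` we
verify that hypothesis from one sign:

* `fderiv_apply_circleTangent_of_eqOn_sphere` — `DP(z)` fixes the tangent vector `J z`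
  (`circleTangent`, the quarter-turn);
* `slDeriv_injective_of_inner_fderiv_pos` — if `⟪DP(z) z, z⟫ > 0` then all
  `id + t (DP(z) - id)`, `t ∈ [0, 1]`, are injective;
* `inner_fderiv_ne_zero_of_leftInverse`, `inner_fderiv_pos_or_neg` — for a local
  diffeomorphism the sign `⟪DP(z) z, z⟫` never vanishes, hence (the circle being connected) is
  constant: `P` preserves or exchanges the two sides of the circle;
* `circleInv` (Mathlib's `EuclideanGeometry.inversion 0 1`, `= w / ‖w‖²`),
  `hasFDerivAt_circleInv`, `inner_fderiv_circleInv_comp` — composing with the inversion in the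
  unit circle (the identity on the circle) reverses the sign.

## References

* M. W. Hirsch, *Differential Topology*, GTM 33 (1976), Ch. 8 §1, Thm. 1.3; Ch. 4 §5.
  [HirschDT1976]
-/

open scoped ContDiff Topology RealInnerProductSpace
open Set Function Metric

noncomputable section

namespace Literature.Topology.FourManifolds

namespace CircleGerm

/-- Local notation for the model plane. -/
local notation "E2" => EuclideanSpace ℝ (Fin 2)

/-! ### The quarter-turn and the orthonormal frame `(z, J z)` at a unit vector -/

/-- **The unit tangent field of the circles about the origin**: the quarter-turn
`J (a, b) = (-b, a)`.  (This is the map `Literature.Topology.FourManifolds.quarterTurn` of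
`GluckTwistFibre.lean`; it is restated under a distinct name because that file sits on top of
the Gluck-twist / winding-number imports, which this elementary planar file must not pull in.) [folklore] -/
def circleTangent (z : E2) : E2 := WithLp.toLp 2 ![-z 1, z 0]

/-- `circleTangent_apply_zero`. [folklore] -/
@[simp] theorem circleTangent_apply_zero (z : E2) : circleTangent z 0 = -z 1 := rfl
/-- `circleTangent_apply_one`. [folklore] -/
@[simp] theorem circleTangent_apply_one (z : E2) : circleTangent z 1 = z 0 := rfl

/-- Inner products in the plane, in coordinates. [folklore] -/
theorem inner_E2 (v w : E2) : ⟪v, w⟫ = v 0 * w 0 + v 1 * w 1 := by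
  rw [EuclideanSpace.inner_eq_star_dotProduct]; simp [dotProduct, Fin.sum_univ_two]; ring

/-- `‖v‖² = v₀² + v₁²`. [folklore] -/
theorem norm_sq_E2' (v : E2) : ‖v‖ ^ 2 = v 0 ^ 2 + v 1 ^ 2 := by
  rw [EuclideanSpace.real_norm_sq_eq, Fin.sum_univ_two]

/-- `J z ⊥ z`. [folklore] -/
theorem inner_circleTangent_self (z : E2) : ⟪circleTangent z, z⟫ = 0 := by
  rw [inner_E2]; simp; ring

/-- `z ⊥ J z`. [folklore] -/
theorem inner_self_circleTangent (z : E2) : ⟪z, circleTangent z⟫ = 0 := by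
  rw [real_inner_comm]; exact inner_circleTangent_self z

/-- `‖J z‖ = ‖z‖`. [folklore] -/
theorem norm_circleTangent (z : E2) : ‖circleTangent z‖ = ‖z‖ := by
  have h : ‖circleTangent z‖ ^ 2 = ‖z‖ ^ 2 := by rw [norm_sq_E2', norm_sq_E2']; simp; ring
  rw [← Real.sqrt_sq (norm_nonneg (circleTangent z)), ← Real.sqrt_sq (norm_nonneg z), h]

/-- **The frame decomposition at a unit vector**: `v = ⟪v, z⟫ z + ⟪v, J z⟫ J z`. [folklore] -/
theorem decomp_of_norm_eq_one {z : E2} (hz : ‖z‖ = 1) (v : E2) :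
    v = ⟪v, z⟫ • z + ⟪v, circleTangent z⟫ • circleTangent z := by
  have hz2 : z 0 ^ 2 + z 1 ^ 2 = 1 := by rw [← norm_sq_E2', hz, one_pow]
  ext i
  fin_cases i
  · simp [inner_E2]; linear_combination (-(v 0)) * hz2
  · simp [inner_E2]; linear_combination (-(v 1)) * hz2

/-- A vector orthogonal to `z` and to `J z` (unit `z`) vanishes. [folklore] -/
theorem eq_zero_of_inner_eq_zero {z : E2} (hz : ‖z‖ = 1) {v : E2} (h1 : ⟪v, z⟫ = 0) (h2 : ⟪v, circleTangent z⟫ = 0) :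
    v = 0 := by
  rw [decomp_of_norm_eq_one hz v, h1, h2, zero_smul, zero_smul, add_zero]

/-! ### The circle through `z` with velocity `J z` -/

/-- The great-circle curve `c(t) = cos t • z + sin t • J z` through `z`. [folklore] -/
def circleCurve (z : E2) (t : ℝ) : E2 := Real.cos t • z + Real.sin t • circleTangent z

/-- `circleCurve_zero`. [folklore] -/
theorem circleCurve_zero (z : E2) : circleCurve z 0 = z := by simp [circleCurve]

/-- The curve stays on the unit circle (unit `z`). [folklore] -/
theorem norm_circleCurve {z : E2} (hz : ‖z‖ = 1) (t : ℝ) : ‖circleCurve z t‖ = 1 := by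
  have hz2 : z 0 ^ 2 + z 1 ^ 2 = 1 := by rw [← norm_sq_E2', hz, one_pow]
  have h : ‖circleCurve z t‖ ^ 2 = 1 := by
    rw [norm_sq_E2', circleCurve]
    simp
    nlinarith [Real.cos_sq_add_sin_sq t, hz2]
  have h0 := norm_nonneg (circleCurve z t)
  nlinarith

/-- The velocity of the curve at `t = 0` is `J z`. [folklore] -/
theorem hasDerivAt_circleCurve_zero (z : E2) : HasDerivAt (circleCurve z) (circleTangent z) 0 := by
  have h1 : HasDerivAt (fun t => Real.cos t • z) ((-Real.sin 0) • z) 0 := (Real.hasDerivAt_cos 0).smul_const z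
  have h2 : HasDerivAt (fun t => Real.sin t • circleTangent z) (Real.cos 0 • circleTangent z) 0 :=
    (Real.hasDerivAt_sin 0).smul_const _
  have h := h1.add h2
  simp at h
  exact h

/-! ### A map fixing the circle pointwise fixes the tangent vectors -/

/-- **If `P = id` on the unit circle and `P` is differentiable at the unit vector `z`, then
`DP(z) (J z) = J z`.** [cite: HirschDT1976, Ch. 4 §5] -/
theorem fderiv_apply_circleTangent_of_eqOn_sphere {P : E2 → E2} (hP : ∀ w : E2, ‖w‖ = 1 → P w = w)
    {z : E2} (hz : ‖z‖ = 1) {D : E2 →L[ℝ] E2} (hD : HasFDerivAt P D z) : D (circleTangent z) = circleTangent z := by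
  have hc : HasDerivAt (circleCurve z) (circleTangent z) 0 := hasDerivAt_circleCurve_zero z
  have hD' : HasFDerivAt P D (circleCurve z 0) := by rw [circleCurve_zero]; exact hD
  have h1 : HasDerivAt (P ∘ circleCurve z) (D (circleTangent z)) 0 := hD'.comp_hasDerivAt 0 hc
  have h2 : P ∘ circleCurve z = circleCurve z := funext fun t => hP _ (norm_circleCurve hz t)
  rw [h2] at h1
  exact h1.unique hc

/-! ### Injectivity of the straight-line derivatives from the sign -/

/-- **The straight-line hypothesis from one sign.**  If `D (J z) = J z` and `⟪D z, z⟫ > 0`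
(unit `z`), then `id + t (D - id)` is injective for every `t ∈ [0, 1]`. [cite: HirschDT1976, Ch. 8 §1, Thm. 1.3] -/
theorem slDeriv_injective_of_inner_pos {z : E2} (hz : ‖z‖ = 1) {D : E2 →L[ℝ] E2}
    (hτ : D (circleTangent z) = circleTangent z) (ha : 0 < ⟪D z, z⟫) {t : ℝ} (ht : t ∈ Icc (0 : ℝ) 1) :
    Injective (slDeriv t D) := by
  have hzz : ⟪z, z⟫ = 1 := by rw [real_inner_self_eq_norm_sq, hz, one_pow]
  have hJJ : ⟪circleTangent z, circleTangent z⟫ = 1 := by rw [real_inner_self_eq_norm_sq, norm_circleTangent, hz, one_pow]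
  have hcoef : 0 < (1 - t) + t * ⟪D z, z⟫ := by
    rcases eq_or_lt_of_le ht.1 with h0 | h0
    · rw [← h0]; norm_num
    · nlinarith [ht.2]
  set a := ⟪D z, z⟫ with ha'
  set b := ⟪D z, circleTangent z⟫ with hb'
  have hDz : D z = a • z + b • circleTangent z := decomp_of_norm_eq_one hz (D z)
  -- the kernel is trivial
  have hker : ∀ v : E2, slDeriv t D v = 0 → v = 0 := by
    intro v hv
    have hdec := decomp_of_norm_eq_one hz v
    set α := ⟪v, z⟫ with hα
    set β := ⟪v, circleTangent z⟫ with hβ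
    have himg : slDeriv t D v = (α * ((1 - t) + t * a)) • z + (α * t * b + β) • circleTangent z := by
      have hDv : D v = α • D z + β • circleTangent z := by
        conv_lhs => rw [hdec]
        rw [map_add, map_smul, map_smul, hτ]
      rw [slDeriv_apply, hDv, hDz]
      conv_lhs => rw [hdec]
      simp only [smul_add, smul_smul]
      module
    rw [himg] at hv
    -- take inner products with `z` and `J z`
    have e1 := congrArg (fun w => ⟪w, z⟫) hv
    have e2 := congrArg (fun w => ⟪w, circleTangent z⟫) hv
    simp only [inner_add_left, inner_smul_left, inner_zero_left, hzz, hJJ, inner_circleTangent_self,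
      inner_self_circleTangent, RCLike.conj_to_real, mul_one, mul_zero, add_zero, zero_add] at e1 e2
    have hα0 : α = 0 := by
      rcases mul_eq_zero.1 e1 with h | h
      · exact h
      · linarith
    rw [hα0] at e2
    simp only [zero_mul, zero_add] at e2
    rw [hdec, hα0, e2, zero_smul, zero_smul, add_zero]
  intro v w hvw
  rw [← sub_eq_zero]
  exact hker _ (by rw [map_sub, hvw, sub_self])

/-! ### The sign never vanishes for a local diffeomorphism -/

/-- **For a map with a differentiable left inverse near `z`, the sign `⟪DP(z) z, z⟫` is not zero**
(`P = id` on the circle, unit `z`): `DP(z)` is injective and fixes `J z`, so `DP(z) z ∉ ℝ J z`. [cite: HirschDT1976, Ch. 4 §5] -/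
theorem inner_fderiv_ne_zero_of_leftInverse {P G : E2 → E2} (hP : ∀ w : E2, ‖w‖ = 1 → P w = w)
    {z : E2} (hz : ‖z‖ = 1) {D : E2 →L[ℝ] E2} (hD : HasFDerivAt P D z)
    {D' : E2 →L[ℝ] E2} (hG : HasFDerivAt G D' z) (hGP : ∀ᶠ w in 𝓝 z, G (P w) = w) : ⟪D z, z⟫ ≠ 0 := by
  intro h0
  have hτ := fderiv_apply_circleTangent_of_eqOn_sphere hP hz hD
  -- `D' ∘ D = id`
  have hPz : P z = z := hP z hz
  have hG' : HasFDerivAt G D' (P z) := by rw [hPz]; exact hG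
  have hcomp : HasFDerivAt (G ∘ P) (D'.comp D) z := hG'.comp z hD
  have hid : HasFDerivAt (G ∘ P) (ContinuousLinearMap.id ℝ E2) z :=
    (hasFDerivAt_id z).congr_of_eventuallyEq (hGP.mono fun w hw => hw)
  have heq : D'.comp D = ContinuousLinearMap.id ℝ E2 := hcomp.unique hid
  have hinj : Injective D := by
    intro v w hvw
    have := congrArg D' hvw
    have h1 : D' (D v) = v := by simpa using congrArg (fun L : E2 →L[ℝ] E2 => L v) heq
    have h2 : D' (D w) = w := by simpa using congrArg (fun L : E2 →L[ℝ] E2 => L w) heq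
    rw [← h1, ← h2, this]
  -- `D z` is orthogonal to `z`, hence a multiple of `J z`, hence `D (z - c J z) = 0`
  have hdec := decomp_of_norm_eq_one hz (D z)
  rw [h0, zero_smul, zero_add] at hdec
  set c := ⟪D z, circleTangent z⟫ with hc
  have hker : D (z - c • circleTangent z) = 0 := by rw [map_sub, map_smul, hτ, ← hdec, sub_self]
  have hzero : z - c • circleTangent z = 0 := hinj (by rw [hker, map_zero])
  have := congrArg (fun w => ⟪w, z⟫) hzero
  simp only [inner_sub_left, inner_smul_left, inner_circleTangent_self, RCLike.conj_to_real, mul_zero, sub_zero,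
    inner_zero_left, real_inner_self_eq_norm_sq, hz, one_pow] at this
  exact one_ne_zero this

/-- **The sign is constant along the circle.**  If `P` is `C¹` on an open set containing the
unit circle, `P = id` on the circle and the sign `⟪DP(z) z, z⟫` never vanishes there, then it is
everywhere positive or everywhere negative (the circle is connected). [folklore] -/
theorem inner_fderiv_pos_or_neg {P : E2 → E2} {U : Set E2} (hU : IsOpen U) (hCU : sphere (0 : E2) 1 ⊆ U)
    (hP : ContDiffOn ℝ 1 P U) (hne : ∀ z ∈ sphere (0 : E2) 1, ⟪fderiv ℝ P z z, z⟫ ≠ 0) :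
    (∀ z ∈ sphere (0 : E2) 1, 0 < ⟪fderiv ℝ P z z, z⟫) ∨ (∀ z ∈ sphere (0 : E2) 1, ⟪fderiv ℝ P z z, z⟫ < 0) := by
  have hcont : ContinuousOn (fun z : E2 => ⟪fderiv ℝ P z z, z⟫) (sphere (0 : E2) 1) := by
    have h1 : ContinuousOn (fun z : E2 => fderiv ℝ P z) U := hP.continuousOn_fderiv_of_isOpen hU le_rfl
    have h2 : ContinuousOn (fun z : E2 => fderiv ℝ P z z) U :=
      ContinuousOn.clm_apply h1 continuousOn_id
    exact ((h2.mono hCU).inner continuousOn_id)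
  have hconn : IsPreconnected (sphere (0 : E2) 1) := by
    refine isPreconnected_sphere ?_ (0 : E2) 1
    rw [← Module.finrank_eq_rank]
    simp
  by_contra h
  rw [not_or] at h
  obtain ⟨h1, h2⟩ := h
  simp only [not_forall, not_lt] at h1 h2
  obtain ⟨z₁, hz₁, hle₁⟩ := h1
  obtain ⟨z₂, hz₂, hle₂⟩ := h2
  have hlt₁ : ⟪fderiv ℝ P z₁ z₁, z₁⟫ < 0 := lt_of_le_of_ne hle₁ (hne z₁ hz₁)
  have hlt₂ : 0 < ⟪fderiv ℝ P z₂ z₂, z₂⟫ := lt_of_le_of_ne hle₂ (Ne.symm (hne z₂ hz₂))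
  have h0 : (0 : ℝ) ∈ (fun z : E2 => ⟪fderiv ℝ P z z, z⟫) '' sphere (0 : E2) 1 :=
    hconn.intermediate_value hz₁ hz₂ hcont ⟨hlt₁.le, hlt₂.le⟩
  obtain ⟨z, hz, hz0⟩ := h0
  exact hne z hz hz0

/-! ### The inversion in the unit circle reverses the sign -/

/-- **The inversion in the unit circle** `w ↦ w / ‖w‖²` of the punctured plane (the identity
on the unit circle, exchanging its two sides): Mathlib's `EuclideanGeometry.inversion 0 1`. [folklore] -/
abbrev circleInv : E2 → E2 := EuclideanGeometry.inversion (0 : E2) 1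

/-- **The inversion in coordinates-free form**: `circleInv w = w / ‖w‖²`. [folklore] -/
theorem circleInv_def (w : E2) : circleInv w = (‖w‖ ^ 2)⁻¹ • w := by
  show EuclideanGeometry.inversion (0 : E2) 1 w = _
  rw [EuclideanGeometry.inversion, dist_zero_right, vsub_eq_sub, sub_zero, vadd_eq_add, add_zero, one_div, inv_pow]

/-- `circleInv` as a function. [folklore] -/
theorem circleInv_eq_fun : (circleInv : E2 → E2) = fun w => (‖w‖ ^ 2)⁻¹ • w := funext circleInv_def

/-- The inversion fixes the unit circle pointwise. [folklore] -/
theorem circleInv_of_norm_eq_one {w : E2} (hw : ‖w‖ = 1) : circleInv w = w := by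
  rw [circleInv_def, hw]; simp

/-- `‖circleInv w‖ = ‖w‖⁻¹`. [folklore] -/
theorem norm_circleInv (w : E2) : ‖circleInv w‖ = ‖w‖⁻¹ := by
  rw [circleInv_def, norm_smul, Real.norm_eq_abs, abs_of_nonneg (by positivity)]
  by_cases h : ‖w‖ = 0
  · rw [h]; simp
  · field_simp

/-- The inversion is an involution off the origin. [folklore] -/
theorem circleInv_circleInv {w : E2} (hw : w ≠ 0) : circleInv (circleInv w) = w := by
  have h : ‖w‖ ≠ 0 := norm_ne_zero_iff.2 hw
  rw [circleInv_def (circleInv w), norm_circleInv, circleInv_def, smul_smul]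
  conv_rhs => rw [← one_smul ℝ w]
  congr 1
  field_simp

/-- The inversion is smooth off the origin. [folklore] -/
theorem contDiffAt_circleInv {w : E2} (hw : w ≠ 0) : ContDiffAt ℝ ∞ circleInv w := by
  rw [circleInv_eq_fun]
  have h1 : ContDiffAt ℝ ∞ (fun w : E2 => ‖w‖ ^ 2) w := (contDiffAt_norm ℝ hw).pow 2
  exact (h1.inv (by positivity)).smul contDiffAt_id

/-- **The derivative of the inversion at a unit vector is the reflection `v ↦ v - 2⟪v, z⟫ z`**
(Mathlib's `EuclideanGeometry.hasFDerivAt_inversion` gives it as the reflection in `(ℝ z)ᗮ`;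
here in the form used below). [folklore] -/
theorem hasFDerivAt_circleInv {z : E2} (hz : ‖z‖ = 1) :
    HasFDerivAt circleInv (ContinuousLinearMap.id ℝ E2 - (2 : ℝ) • (innerSL ℝ z).smulRight z) z := by
  rw [circleInv_eq_fun]
  have h1 : HasFDerivAt (fun w : E2 => ‖w‖ ^ 2) (2 • innerSL ℝ z) z := (hasStrictFDerivAt_norm_sq z).hasFDerivAt
  have hz2 : ‖z‖ ^ 2 = 1 := by rw [hz, one_pow]
  have hne : ‖z‖ ^ 2 ≠ 0 := by rw [hz2]; exact one_ne_zero
  have h2 : HasFDerivAt (fun w : E2 => (‖w‖ ^ 2)⁻¹)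
      ((ContinuousLinearMap.toSpanSingleton ℝ (-((‖z‖ ^ 2) ^ 2)⁻¹)).comp (2 • innerSL ℝ z)) z :=
    (hasFDerivAt_inv hne).comp z h1
  have h3 := h2.smul (hasFDerivAt_id z)
  refine h3.congr_fderiv ?_
  refine ContinuousLinearMap.ext fun v => ?_
  simp [hz2, smul_smul, ContinuousLinearMap.smulRight_apply, ContinuousLinearMap.toSpanSingleton_apply]
  module

/-- **Composing with the inversion reverses the sign**: for `P = id` on the circle with
derivative `D` at the unit vector `z`, `circleInv ∘ P` has derivative `R ∘ D` with
`⟪R (D z), z⟫ = -⟪D z, z⟫`. [folklore] -/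
theorem inner_fderiv_circleInv_comp {P : E2 → E2} (hP : ∀ w : E2, ‖w‖ = 1 → P w = w)
    {z : E2} (hz : ‖z‖ = 1) {D : E2 →L[ℝ] E2} (hD : HasFDerivAt P D z) :
    HasFDerivAt (circleInv ∘ P) ((ContinuousLinearMap.id ℝ E2 - (2 : ℝ) • (innerSL ℝ z).smulRight z).comp D) z ∧
      ⟪((ContinuousLinearMap.id ℝ E2 - (2 : ℝ) • (innerSL ℝ z).smulRight z).comp D) z, z⟫ = -⟪D z, z⟫ := by
  have hPz : P z = z := hP z hz
  have hI : HasFDerivAt circleInv (ContinuousLinearMap.id ℝ E2 - (2 : ℝ) • (innerSL ℝ z).smulRight z) (P z) := by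
    rw [hPz]; exact hasFDerivAt_circleInv hz
  refine ⟨hI.comp z hD, ?_⟩
  have hzz : ⟪z, z⟫ = 1 := by rw [real_inner_self_eq_norm_sq, hz, one_pow]
  simp only [ContinuousLinearMap.coe_comp, comp_apply]
  simp [inner_sub_left, inner_smul_left, real_inner_comm z (D z), hz]
  ring

/-- The composite with the inversion still fixes the circle pointwise. [folklore] -/
theorem circleInv_comp_of_eqOn_sphere {P : E2 → E2} (hP : ∀ w : E2, ‖w‖ = 1 → P w = w) (w : E2) (hw : ‖w‖ = 1) :
    (circleInv ∘ P) w = w := by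
  rw [comp_apply, hP w hw, circleInv_of_norm_eq_one hw]

end CircleGerm

end Literature.Topology.FourManifolds
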